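import Mathlib
import Literature.Analysis.FluidPDE.SuitableWeak
import Literature.Analysis.FluidPDE.WeakSolution
import Literature.Analysis.FluidPDE.CKNVelocityIntegrability
import Literature.Analysis.FluidPDE.LocalLerayCubicIntegrability
import Literature.Analysis.FluidPDE.LerayHopfProofs
import HarnessLib

/-!
# Tools for the CONFINED stratum of the crux `EulerZoomLiouville.PowerGaugeEulerLiouville`

Route `EulerZoomLiouville` (NavierStokesRegularity), crux E = stmt-NavierStokesRegularity-19832
`PowerGaugeEulerLiouville` (Seregin's power-gauged ancient Euler class is trivial; OPEN on `0 < ρ ≤ 1/2`).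
Companion of `EulerZoomLiouvillePowerGaugeEulerLiouvilleConfined.lean` (no Euler collapse from zero for
spatially confined members); route-independent tools:

* `exists_box_of_isCompact_subset_slab` — a compact subset of `(−∞,0) × ℝ³` lies in a box
  `[−T, −δ] × B̄(0, R₀)`;
* `locallyIntegrableOn_cube_of_gauge` — **`|u|³ ∈ L¹_loc` on the slab** for a suitable weak solution with a
  weak gradient whose `E`-gauge at the origin is finite on all parabolic cylinders `Q_a(0,0)` (these
  exhaust the slab): energy class + `∇u ∈ L²` ⇒ `u ∈ L^{10/3}_{t,x}` on cylinders (tree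
  `lintegral_rpow_ten_thirds_lt_top_of_energy`, Lemarié-Rieusset 2016 (13.18)) ⇒ `|u|³ ∈ L¹_loc`
  (the hypothesis `hu3` of the tree's sliced local energy inequalities);
* `exists_bump_eq_one_ball` — a smooth bump `φ ∈ [0,1]`, `φ ≡ 1` and `∇φ = 0` on `B(0,r)`, supported in
  `B(0, r+1)`;
* `integrable_sq_mul_of_lintegral_ball` — `‖f‖² φ` is integrable with `∫ ‖f‖² φ ≤ ∫_{B} ‖f‖²` once
  `∫_B ‖f‖² < ∞` on a ball `B` containing the support of `φ`.

WHAT THIS IS NOT: not NS — bookkeeping for the stratum. [folklore]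
-/

noncomputable section

set_option linter.dupNamespace false

open MeasureTheory Set Filter Topology Metric Function TopologicalSpace
open scoped ENNReal NNReal InnerProductSpace RealInnerProductSpace Laplacian

namespace Summit.NavierStokesRegularity.NavierStokesRegularity.Theorems.PowerGaugeEulerLiouville

open Literature.Analysis Literature.Analysis.FunctionSpaces Literature.Analysis.FluidPDE

/-! ## `|u|³ ∈ L¹_loc` on the slab for members of the gauged class -/

/-- A compact subset of the ancient slab `(−∞,0) × ℝ³` lies in a box `[−T, −δ] × B̄(0, R₀)` with
`0 < δ`, `δ < T`, `0 < R₀`. [folklore] -/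
theorem exists_box_of_isCompact_subset_slab {K : Set (ℝ × EuclideanSpace ℝ (Fin 3))} (hK : IsCompact K)
    (hKs : K ⊆ Iio (0 : ℝ) ×ˢ (univ : Set (EuclideanSpace ℝ (Fin 3)))) :
    ∃ T δ R₀ : ℝ, 0 < δ ∧ δ < T ∧ 0 < R₀ ∧
      K ⊆ Icc (-T) (-δ) ×ˢ closedBall (0 : EuclideanSpace ℝ (Fin 3)) R₀ := by
  -- time coordinates: compact subset of `(-∞, 0)`
  have h1 : IsCompact (Prod.fst '' K) := hK.image continuous_fst
  have h2 : IsCompact (Prod.snd '' K) := hK.image continuous_snd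
  obtain ⟨R₁, hR₁⟩ := h2.isBounded.subset_closedBall (0 : EuclideanSpace ℝ (Fin 3))
  obtain ⟨T₁, hT₁⟩ := h1.isBounded.subset_closedBall (0 : ℝ)
  -- the sup of the time coordinates is attained and negative (if `K` is nonempty)
  rcases K.eq_empty_or_nonempty with hKe | hKne
  · exact ⟨2, 1, 1, one_pos, by norm_num, one_pos, by simp [hKe]⟩
  obtain ⟨t₀, ht₀mem, ht₀max⟩ := h1.exists_isMaxOn (hKne.image _) (continuous_id (X := ℝ)).continuousOn
  obtain ⟨z₀, hz₀K, rfl⟩ := ht₀mem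
  have hz₀neg : z₀.1 < 0 := (hKs hz₀K).1
  refine ⟨max (T₁ + 1) (-z₀.1 + 1), -z₀.1, max R₁ 1, by linarith, ?_, by positivity, ?_⟩
  · exact lt_of_lt_of_le (by linarith) (le_max_right _ _)
  · intro z hz
    refine ⟨⟨?_, ?_⟩, ?_⟩
    · have := hT₁ (mem_image_of_mem Prod.fst hz)
      rw [mem_closedBall, Real.dist_eq, sub_zero] at this
      have h3 := (abs_le.1 this).1
      have h4 : T₁ ≤ max (T₁ + 1) (-z₀.1 + 1) := le_trans (by linarith) (le_max_left _ _)
      linarith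
    · have := ht₀max (mem_image_of_mem Prod.fst hz)
      simpa using this
    · exact (closedBall_subset_closedBall (le_max_left _ _)) (hR₁ (mem_image_of_mem Prod.snd hz))

/-- **`|u|³ ∈ L¹_loc` on the ancient slab for members of the gauged class.**  The energy class
`u ∈ L^∞_t L²_x` (structure field), the weak gradient `H` and the finiteness of the `E`-gauge on the
parabolic cylinders `Q_a(0,0)` (which exhaust the slab) give `u ∈ L^{10/3}_{t,x}` on every cylinder
compactly inside the slab (tree `lintegral_rpow_ten_thirds_lt_top_of_energy`, Lemarié-Rieusset 2016
(13.18)), hence `|u|³ ∈ L¹_loc`. [folklore] -/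
theorem locallyIntegrableOn_cube_of_gauge {ρ : ℝ}
    {u : ℝ → EuclideanSpace ℝ (Fin 3) → EuclideanSpace ℝ (Fin 3)} {p : ℝ → EuclideanSpace ℝ (Fin 3) → ℝ}
    {H : ℝ → EuclideanSpace ℝ (Fin 3) → EuclideanSpace ℝ (Fin 3) →L[ℝ] EuclideanSpace ℝ (Fin 3)} {c : ℝ≥0}
    (hsw : IsSuitableWeakSolutionOn (slab (EuclideanSpace ℝ (Fin 3)) (Iio 0) isOpen_Iio) 0 0 u p)
    (hH : HasWeakSpatialGradientOn (slab (EuclideanSpace ℝ (Fin 3)) (Iio 0) isOpen_Iio) u H)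
    (hE : ∀ a : ℝ, 0 < a →
      ENNReal.ofReal (a ^ ρ) * cknE a (0 : ℝ × EuclideanSpace ℝ (Fin 3)) H ≤ (c : ℝ≥0∞)) :
    LocallyIntegrableOn (fun z : ℝ × EuclideanSpace ℝ (Fin 3) => ‖u z.1 z.2‖ ^ 3)
      ((slab (EuclideanSpace ℝ (Fin 3)) (Iio 0) isOpen_Iio : Opens (ℝ × EuclideanSpace ℝ (Fin 3))) :
        Set (ℝ × EuclideanSpace ℝ (Fin 3))) volume := by
  refine (locallyIntegrableOn_iff (slab (EuclideanSpace ℝ (Fin 3)) (Iio 0) isOpen_Iio).isOpen.isLocallyClosed).2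
    fun K hK hKc => ?_
  have hKs : K ⊆ Iio (0 : ℝ) ×ˢ (univ : Set (EuclideanSpace ℝ (Fin 3))) := by simpa [slab] using hK
  obtain ⟨T, δ, R₀, hδ, hδT, hR₀, hKbox⟩ := exists_box_of_isCompact_subset_slab hKc hKs
  -- the open cylinder `Ω ⊇ K` compactly inside the slab
  set S : Set (ℝ × EuclideanSpace ℝ (Fin 3)) :=
    Ioo (-(T + 1)) (-(δ / 2)) ×ˢ ball (0 : EuclideanSpace ℝ (Fin 3)) (R₀ + 1) with hS
  set Ω : Opens (ℝ × EuclideanSpace ℝ (Fin 3)) := ⟨S, isOpen_Ioo.prod isOpen_ball⟩ with hΩ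
  have hKS : K ⊆ S := by
    intro z hz
    obtain ⟨⟨h1, h2⟩, h3⟩ := hKbox hz
    exact ⟨⟨by linarith, by linarith⟩, mem_ball.2 (lt_of_le_of_lt (mem_closedBall.1 h3) (by linarith))⟩
  set K' : Set (ℝ × EuclideanSpace ℝ (Fin 3)) :=
    Icc (-(T + 1)) (-(δ / 2)) ×ˢ closedBall (0 : EuclideanSpace ℝ (Fin 3)) (R₀ + 1) with hK'
  have hK'c : IsCompact K' := isCompact_Icc.prod (isCompact_closedBall _ _)
  have hSK' : S ⊆ K' := prod_mono Ioo_subset_Icc_self ball_subset_closedBall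
  have hK's : K' ⊆ ((slab (EuclideanSpace ℝ (Fin 3)) (Iio 0) isOpen_Iio : Opens (ℝ × EuclideanSpace ℝ (Fin 3))) :
      Set (ℝ × EuclideanSpace ℝ (Fin 3))) := by
    rintro ⟨t, x⟩ ⟨ht, -⟩
    rw [SetLike.mem_coe, mem_slab]
    exact lt_of_le_of_lt ht.2 (by linarith)
  have hΩs : Ω ≤ slab (EuclideanSpace ℝ (Fin 3)) (Iio 0) isOpen_Iio := fun z hz => hK's (hSK' hz)
  -- (i) the energy class on `K'`
  have hEn : ∃ C : ℝ≥0, ∀ᵐ t : ℝ, ∫⁻ x, (Ω : Set (ℝ × EuclideanSpace ℝ (Fin 3))).indicator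
      (fun z : ℝ × EuclideanSpace ℝ (Fin 3) => ‖u z.1 z.2‖ₑ ^ 2) (t, x) ≤ C := by
    obtain ⟨C, hC⟩ := hsw.energyClass K' hK's hK'c
    refine ⟨C, ?_⟩
    filter_upwards [hC] with t ht
    refine le_trans (lintegral_mono fun x => ?_) ht
    exact indicator_le_indicator_of_subset hSK' (fun _ => bot_le) _
  -- (ii) the gradient is square integrable on `Ω` (finiteness of the `E`-gauge on a big cylinder)
  set a : ℝ := max (Real.sqrt (T + 1) + 1) (R₀ + 1) with ha
  have ha0 : 0 < a := lt_of_lt_of_le (by linarith) (le_max_right _ _)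
  have hSQ : S ⊆ parabolicCylinder a (0 : ℝ × EuclideanSpace ℝ (Fin 3)) := by
    intro z hz
    obtain ⟨⟨h1, h2⟩, h3⟩ := hz
    have hsq : Real.sqrt (T + 1) ^ 2 = T + 1 := Real.sq_sqrt (by linarith)
    have ha1 : Real.sqrt (T + 1) + 1 ≤ a := le_max_left _ _
    have ha2 : T + 1 < a ^ 2 := by nlinarith [Real.sqrt_nonneg (T + 1)]
    simp only [parabolicCylinder, mem_prod, mem_Ioo, mem_ball, Prod.fst_zero, Prod.snd_zero, zero_sub]
    exact ⟨⟨by linarith, by linarith⟩, lt_of_lt_of_le (mem_ball.1 h3) (le_max_right _ _)⟩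
  have hGsq : ∫⁻ z in (Ω : Set (ℝ × EuclideanSpace ℝ (Fin 3))),
      ENNReal.ofReal (frobeniusNormSq (H z.1 z.2)) < ∞ := by
    have h1 := hE a ha0
    have hne : ENNReal.ofReal (a ^ ρ) ≠ 0 := by
      rw [ENNReal.ofReal_ne_zero_iff]; exact Real.rpow_pos_of_pos ha0 _
    have hElt : cknE a (0 : ℝ × EuclideanSpace ℝ (Fin 3)) H < ⊤ := by
      have h2 : ENNReal.ofReal (a ^ ρ) * cknE a (0 : ℝ × EuclideanSpace ℝ (Fin 3)) H < ⊤ :=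
        lt_of_le_of_lt h1 ENNReal.coe_lt_top
      rcases ENNReal.mul_lt_top_iff.1 h2 with h | h | h
      · exact h.2
      · exact (hne h).elim
      · rw [h]; exact ENNReal.zero_lt_top
    have hJlt : ∫⁻ q in parabolicCylinder a (0 : ℝ × EuclideanSpace ℝ (Fin 3)),
        ENNReal.ofReal (frobeniusNormSq (H q.1 q.2)) < ⊤ := by
      have hne' : (ENNReal.ofReal a)⁻¹ ≠ 0 := ENNReal.inv_ne_zero.2 ENNReal.ofReal_ne_top
      unfold cknE at hElt
      rcases ENNReal.mul_lt_top_iff.1 hElt with h | h | h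
      · exact h.2
      · exact (hne' h).elim
      · rw [h]; exact ENNReal.zero_lt_top
    exact lt_of_le_of_lt (lintegral_mono_set hSQ) hJlt
  -- (iii) `u ∈ L^{10/3}(Ω)`
  have h10 := lintegral_rpow_ten_thirds_lt_top_of_energy (finrank_euclideanSpace_fin (𝕜 := ℝ) (n := 3))
    hEn (hH.mono hΩs) hGsq (a := -(T + 1)) (b := -(δ / 2)) (xB := 0) (R := R₀ + 1) Subset.rfl
  -- (iv) `|u|³` is integrable on `S ⊇ K`
  have hmeas : AEStronglyMeasurable (uncurry u) (volume.restrict S) :=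
    (hH.mono hΩs).locallyIntegrableOn.aestronglyMeasurable
  have hSfin : volume S < ⊤ := by
    rw [hS, Measure.volume_eq_prod, Measure.prod_prod]
    exact ENNReal.mul_lt_top measure_Ioo_lt_top measure_ball_lt_top
  have hint : IntegrableOn (fun z : ℝ × EuclideanSpace ℝ (Fin 3) => ‖u z.1 z.2‖ ^ 3) S volume := by
    refine ⟨(hmeas.norm.pow 3).congr (Eventually.of_forall fun z => rfl), ?_⟩
    rw [hasFiniteIntegral_iff_enorm]
    have e1 : ∀ z : ℝ × EuclideanSpace ℝ (Fin 3), ‖‖u z.1 z.2‖ ^ 3‖ₑ = ‖u z.1 z.2‖ₑ ^ (3 : ℕ) := by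
      intro z
      rw [Real.enorm_eq_ofReal (by positivity), ← ofReal_norm, ENNReal.ofReal_pow (norm_nonneg _)]
    simp_rw [e1]
    calc ∫⁻ z in S, ‖u z.1 z.2‖ₑ ^ (3 : ℕ)
        ≤ ∫⁻ z in S, (1 + ‖u z.1 z.2‖ₑ ^ (10 / 3 : ℝ)) := lintegral_mono fun z => IsLocalLeraySolution.pow_three_le_one_add_rpow _
      _ = volume S + ∫⁻ z in S, ‖u z.1 z.2‖ₑ ^ (10 / 3 : ℝ) := by
          rw [lintegral_add_left measurable_const, lintegral_const, Measure.restrict_apply_univ, one_mul]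
      _ < ⊤ := ENNReal.add_lt_top.2 ⟨hSfin, h10⟩
  exact hint.mono_set hKS

/-! ## Auxiliary: bumps equal to one on a ball; slices with finite local energy -/

/-- A smooth compactly supported `φ : ℝ³ → [0,1]` equal to `1` on `B(0, r)` with vanishing gradient
there, supported in `B̄(0, r + 1)`. [folklore] -/
theorem exists_bump_eq_one_ball {r : ℝ} (hr : 0 < r) :
    ∃ φ : EuclideanSpace ℝ (Fin 3) → ℝ, ContDiff ℝ (⊤ : ℕ∞) φ ∧ HasCompactSupport φ ∧ (∀ x, 0 ≤ φ x) ∧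
      (∀ x, φ x ≤ 1) ∧ (∀ x ∈ ball (0 : EuclideanSpace ℝ (Fin 3)) r, φ x = 1) ∧
      (∀ x ∈ ball (0 : EuclideanSpace ℝ (Fin 3)) r, gradient φ x = 0) ∧
      (∀ x, φ x ≠ 0 → x ∈ ball (0 : EuclideanSpace ℝ (Fin 3)) (r + 1)) := by
  let β : ContDiffBump (0 : EuclideanSpace ℝ (Fin 3)) := ⟨r, r + 1, hr, by linarith⟩
  refine ⟨β, β.contDiff, β.hasCompactSupport, fun x => β.nonneg, fun x => β.le_one,
    fun x hx => β.one_of_mem_closedBall (ball_subset_closedBall hx), fun x hx => ?_, fun x hx => ?_⟩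
  · have h1 : (β : EuclideanSpace ℝ (Fin 3) → ℝ) =ᶠ[𝓝 x] (fun _ => (1 : ℝ)) :=
      β.eventuallyEq_one_of_mem_ball hx
    rw [gradient, h1.fderiv_eq]
    simp
  · have : x ∈ Function.support (β : EuclideanSpace ℝ (Fin 3) → ℝ) := hx
    rwa [β.support_eq] at this

/-- A slice with finite `L²` mass on a ball containing the support of a bounded weight `φ ≥ 0` has
`‖u‖² φ` integrable, with `∫ ‖u‖² φ ≤ (∫⁻_{B} ‖u‖ₑ²).toReal`. [folklore] -/
theorem integrable_sq_mul_of_lintegral_ball {f : EuclideanSpace ℝ (Fin 3) → EuclideanSpace ℝ (Fin 3)}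
    (hf : AEStronglyMeasurable f volume) {R' : ℝ}
    (hfin : ∫⁻ x in ball (0 : EuclideanSpace ℝ (Fin 3)) R', ‖f x‖ₑ ^ 2 < ⊤)
    {φ : EuclideanSpace ℝ (Fin 3) → ℝ} (hφc : Continuous φ) (hφ0 : ∀ x, 0 ≤ φ x) (hφ1 : ∀ x, φ x ≤ 1)
    (hφR : ∀ x, φ x ≠ 0 → x ∈ ball (0 : EuclideanSpace ℝ (Fin 3)) R') :
    Integrable (fun x => ‖f x‖ ^ 2 * φ x) volume ∧
      ∫ x, ‖f x‖ ^ 2 * φ x ≤ (∫⁻ x in ball (0 : EuclideanSpace ℝ (Fin 3)) R', ‖f x‖ₑ ^ 2).toReal := by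
  set B := ball (0 : EuclideanSpace ℝ (Fin 3)) R' with hB
  -- the majorant `1_B ‖f‖²`
  have hmaj_int : Integrable (B.indicator fun x => ‖f x‖ ^ 2) volume := by
    rw [integrable_indicator_iff measurableSet_ball]
    refine ⟨(hf.norm.pow 2).restrict, ?_⟩
    rw [hasFiniteIntegral_iff_enorm]
    refine lt_of_le_of_lt (lintegral_mono fun x => le_of_eq ?_) hfin
    rw [Real.enorm_eq_ofReal (by positivity), ← ofReal_norm, ENNReal.ofReal_pow (norm_nonneg _)]
  have hle : ∀ x, ‖f x‖ ^ 2 * φ x ≤ B.indicator (fun x => ‖f x‖ ^ 2) x := by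
    intro x
    by_cases hx : φ x = 0
    · rw [hx, mul_zero]; exact indicator_nonneg (fun y _ => sq_nonneg ‖f y‖) _
    · rw [indicator_of_mem (hφR x hx)]
      calc ‖f x‖ ^ 2 * φ x ≤ ‖f x‖ ^ 2 * 1 := by gcongr; exact hφ1 x
        _ = ‖f x‖ ^ 2 := mul_one _
  have hmeas : AEStronglyMeasurable (fun x => ‖f x‖ ^ 2 * φ x) volume :=
    (hf.norm.pow 2).mul hφc.aestronglyMeasurable
  have hint : Integrable (fun x => ‖f x‖ ^ 2 * φ x) volume :=
    hmaj_int.mono' hmeas (Eventually.of_forall fun x => by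
      rw [Real.norm_eq_abs, abs_of_nonneg (mul_nonneg (sq_nonneg _) (hφ0 x))]; exact hle x)
  refine ⟨hint, ?_⟩
  calc ∫ x, ‖f x‖ ^ 2 * φ x ≤ ∫ x, B.indicator (fun x => ‖f x‖ ^ 2) x :=
        integral_mono hint hmaj_int hle
    _ = ∫ x in B, ‖f x‖ ^ 2 := integral_indicator measurableSet_ball
    _ = (∫⁻ x in B, ‖f x‖ₑ ^ 2).toReal := by
        rw [integral_eq_lintegral_of_nonneg_ae (Eventually.of_forall fun x => sq_nonneg ‖f x‖)
          ((hf.norm.pow 2).restrict.congr (Eventually.of_forall fun x => rfl))]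
        congr 1
        refine lintegral_congr fun x => ?_
        rw [← ofReal_norm, ENNReal.ofReal_pow (norm_nonneg _)]

end Summit.NavierStokesRegularity.NavierStokesRegularity.Theorems.PowerGaugeEulerLiouville

end
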